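import Summits.QuantumFields.YangMills.Theorems.FlatTubeReductionProfileLevelSetVolumeSlow
import Summits.QuantumFields.YangMills.Theorems.FlatTubeReductionProfileVolumeGrowth
import HarnessLib

/-!
# Volume growth AT A SLOW DATUM `w`, closed form: `∫_{β·kinDefect(oT w v,oT w v′,g) ≤ t} Ω·fpWeight·Ω ≤ V_w·(t+1)^{3n}` with
# `V_w = fpZ·(π²/12)^n(3L)^{3n}3^{3n}(√β)^{-3n}·[3^{3n}(1 + 2(3√β τ_w)^{3n})·I₀² + ((5√2)^{3n}+(√2)^{3n})·I₀·M_{3n}]` — the `τ_w ≍ δ₁` loss is the polynomial `(√β τ_w)^{3n}`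
# (route `FlatTubeReduction`, crux K1 `NearFlatRatioLaw` stmt-QuantumFields-24720; seat `ym-line-ftr-p1` g12; rate twin «ratepack-v3 / frozen fibres»; R2b1 RECORD rung — no summit
# statement is proved here)

WHY (memo `Cruxes/NearFlatRatioLaw/Lines/ratepack-v3-frozen-g12.md` §5.11 (2)).  The tail AT `u` of the core+tail sandwich needs the volume growth of the level `N_w = β·kinDefect(oT w v, oT w v′, g)`
(`w = dud⁻¹`); same Fubini as at `w = 1` with `a = √2‖v̂‖ + τ_w` (lane A's `norm_su2Quat_orthoTube_sub_one_le`); the extra `τ_w ≍ δ₁` costs a POLYNOMIAL factor `(√β τ_w)^{3n}` which the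
power threshold of the tails absorbs.
  ★★ `profile_volume_growth_slow` (the `hV` input of `setIntegral_weighted_tail_le` for the tails AT `u`).
HONEST FRAMING: Fubini bookkeeping; femto rung R2b1 (RECORD label); not infinite volume, not a gap, not Clay.  No defs, no named facts, no `sorry`.
-/

set_option autoImplicit false

noncomputable section

open MeasureTheory Filter Topology Real Set
open scoped BigOperators ENNReal
open Literature.MathematicalPhysics.QuantumFieldTheory
open Literature.MathematicalPhysics.QuantumLattice

namespace Summit.QuantumFields.YangMills.Theorems.FemtoTransferGap.RateTube

open Summit.QuantumFields.YangMills.Theorems.FemtoTransferGap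
open Summit.QuantumFields.YangMills.Theorems.FemtoTransferGap.TwoLattice
open Summit.QuantumFields.YangMills.Theorems.FemtoTransferGap.TwoLattice.ConstTube
open Summit.QuantumFields.YangMills.Theorems.FemtoTransferGap.TwoLattice.Avg
open Summit.QuantumFields.YangMills.Theorems.FemtoTransferGap.TwoLattice.Stiff (LinkSpace)

variable {L : ℕ} [NeZero L]

set_option maxHeartbeats 1200000 in
/-- ★★ **Volume growth at a slow datum `w`, closed form** (`‖q(w_k) − 1‖ ≤ τ_w`, data otherwise as in `profile_volume_growth`): for every `t ≥ 0`,
`∫_{β·kinDefect(oT w v,oT w v′,g) ≤ t} Ω(v̂)·fpWeight ε(g)·Ω(v̂′) dμP ≤ [fpZ ε·(π²/12)^n(3L)^{3n}3^{3n}((√β)⁻¹)^{3n}·(3^{3n}(1 + 2(√β·3τ_w)^{3n})·I₀² + ((5√2)^{3n} + (√2)^{3n})·I₀·M_{3n})]·(t+1)^{3n}`.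
[cite: Luscher1983, §3] -/
theorem profile_volume_growth_slow {β : ℝ} (hβ : 0 < β) (w : GaugeConfig 3 1 SU2) {τw : ℝ} (hτw0 : 0 ≤ τw) (hw : ∀ k : Fin 3, ‖su2Quat (w (0, k)) - 1‖ ≤ τw) {Ω : LinkSpace L → ℝ} (hΩm : Measurable Ω) {CΩ : ℝ} (hCΩ : ∀ x, |Ω x| ≤ CΩ) (hΩ0 : ∀ x, 0 ≤ Ω x) {R : ℝ}
    (hΩt : ∀ v : Edge 3 L → Fin 3 → ℝ, Ω (linkEmbed L v) ≠ 0 → v ∈ capBalancedSet L ∧ ‖linkEmbed L v‖ ≤ R) (ε : ℝ) {t : ℝ} (ht : 0 ≤ t) :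
    ∫ p in {p : (Edge 3 L → Fin 3 → ℝ) × ((Edge 3 L → Fin 3 → ℝ) × (Site 3 L → SU2)) | β * kinDefect L (orthoTube L w p.1) (orthoTube L w p.2.1) p.2.2 ≤ t},
        Ω (linkEmbed L p.1) * (fpWeight L ε p.2.2 * Ω (linkEmbed L p.2.1)) ∂((orthoTransverse L).prod ((orthoTransverse L).prod (gaugeMeasure L))) ≤
      (fpZ ε * ((π ^ 2 / 12) ^ Fintype.card {x : Site 3 L // ¬x = 0} * (3 * (L : ℝ)) ^ (3 * Fintype.card {x : Site 3 L // ¬x = 0}) *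
          3 ^ (3 * Fintype.card {x : Site 3 L // ¬x = 0}) * ((Real.sqrt β)⁻¹) ^ (3 * Fintype.card {x : Site 3 L // ¬x = 0})) *
        (3 ^ (3 * Fintype.card {x : Site 3 L // ¬x = 0}) * (1 + 2 * (Real.sqrt β * (3 * τw)) ^ (3 * Fintype.card {x : Site 3 L // ¬x = 0})) *
            (∫ v, Ω (linkEmbed L v) ∂orthoTransverse L) ^ 2 +
          ((5 * Real.sqrt 2) ^ (3 * Fintype.card {x : Site 3 L // ¬x = 0}) + Real.sqrt 2 ^ (3 * Fintype.card {x : Site 3 L // ¬x = 0})) *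
            (∫ v, Ω (linkEmbed L v) ∂orthoTransverse L) * ∫ v, Ω (linkEmbed L v) * (Real.sqrt β * ‖linkEmbed L v‖) ^ (3 * Fintype.card {x : Site 3 L // ¬x = 0}) ∂orthoTransverse L)) *
        (t + 1) ^ (3 * Fintype.card {x : Site 3 L // ¬x = 0}) := by
  haveI := isFiniteMeasure_orthoTransverse L
  set n : ℕ := Fintype.card {x : Site 3 L // ¬x = 0} with hn
  set π' := orthoTransverse L with hπ
  have hCΩ0 : 0 ≤ CΩ := (abs_nonneg _).trans (hCΩ 0)
  have hle : Measurable (linkEmbed L) := measurable_linkEmbed L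
  -- abbreviations
  set sβ : ℝ := (Real.sqrt β)⁻¹ with hsβ
  have hsβ0 : 0 < sβ := by rw [hsβ]; exact inv_pos.mpr (Real.sqrt_pos.mpr hβ)
  set I₀ : ℝ := ∫ v, Ω (linkEmbed L v) ∂π' with hI₀
  set Mm : ℝ := ∫ v, Ω (linkEmbed L v) * (Real.sqrt β * ‖linkEmbed L v‖) ^ (3 * n) ∂π' with hMm
  obtain ⟨Aw, hAw⟩ : ∃ Aw : ℝ, Aw = 3 ^ (3 * n) * (1 + 2 * (Real.sqrt β * (3 * τw)) ^ (3 * n)) := ⟨_, rfl⟩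
  have hAw1 : 1 ≤ Aw := by
    rw [hAw]
    have h1 : (1 : ℝ) ≤ 3 ^ (3 * n) := one_le_pow₀ (by norm_num)
    have h2 : (0 : ℝ) ≤ 2 * (Real.sqrt β * (3 * τw)) ^ (3 * n) := by positivity
    nlinarith
  have hAw0 : 0 ≤ Aw := le_trans zero_le_one hAw1
  have hI₀0 : 0 ≤ I₀ := integral_nonneg fun v => hΩ0 _
  have hMm0 : 0 ≤ Mm := integral_nonneg fun v => mul_nonneg (hΩ0 _) (by positivity)
  -- the level set at `D = t/β`
  have hset : {p : (Edge 3 L → Fin 3 → ℝ) × ((Edge 3 L → Fin 3 → ℝ) × (Site 3 L → SU2)) | β * kinDefect L (orthoTube L w p.1) (orthoTube L w p.2.1) p.2.2 ≤ t} =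
      {p | kinDefect L (orthoTube L w p.1) (orthoTube L w p.2.1) p.2.2 ≤ t / β} := by
    ext p; simp only [Set.mem_setOf_eq]; rw [le_div_iff₀ hβ, mul_comm]
  rw [hset]
  have hmain := setIntegral_profile_kinLevelSet_le_slow (L := L) w hτw0 hw hΩm hCΩ hΩ0 hΩt ε (t / β)
  refine hmain.trans ?_
  -- pointwise expansion of the box
  have hD : Real.sqrt (t / β) = Real.sqrt t * sβ := by rw [hsβ, Real.sqrt_div ht, div_eq_mul_inv]
  have hbox : ∀ v v' : Edge 3 L → Fin 3 → ℝ,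
      (π ^ 2 / 12 * (3 * L * (Real.sqrt (t / β) + 5 * (Real.sqrt 2 * ‖linkEmbed L v‖ + τw) + (Real.sqrt 2 * ‖linkEmbed L v'‖ + τw))) ^ 3) ^ n ≤
        (π ^ 2 / 12) ^ n * (3 * (L : ℝ)) ^ (3 * n) * 3 ^ (3 * n) * sβ ^ (3 * n) *
          (Aw * (t + 1) ^ (3 * n) + (5 * Real.sqrt 2) ^ (3 * n) * (Real.sqrt β * ‖linkEmbed L v‖) ^ (3 * n) + Real.sqrt 2 ^ (3 * n) * (Real.sqrt β * ‖linkEmbed L v'‖) ^ (3 * n)) := by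
    intro v v'
    have hL0 : (0 : ℝ) ≤ L := Nat.cast_nonneg _
    have e0 : Real.sqrt (t / β) + 5 * (Real.sqrt 2 * ‖linkEmbed L v‖ + τw) + (Real.sqrt 2 * ‖linkEmbed L v'‖ + τw) =
        (Real.sqrt (t / β) + 3 * τw + 3 * τw) + 5 * (Real.sqrt 2 * ‖linkEmbed L v‖) + Real.sqrt 2 * ‖linkEmbed L v'‖ := by ring
    have e1 : (π ^ 2 / 12 * (3 * L * (Real.sqrt (t / β) + 5 * (Real.sqrt 2 * ‖linkEmbed L v‖ + τw) + (Real.sqrt 2 * ‖linkEmbed L v'‖ + τw))) ^ 3) ^ n =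
        (π ^ 2 / 12) ^ n * (3 * (L : ℝ)) ^ (3 * n) * ((Real.sqrt (t / β) + 3 * τw + 3 * τw) + 5 * (Real.sqrt 2 * ‖linkEmbed L v‖) + Real.sqrt 2 * ‖linkEmbed L v'‖) ^ (3 * n) := by
      rw [e0, mul_pow, mul_pow, mul_pow, ← pow_mul, ← pow_mul, mul_assoc]
    rw [e1]
    have h3 := pow_add_three_le (by positivity : 0 ≤ Real.sqrt (t / β) + 3 * τw + 3 * τw) (by positivity : 0 ≤ 5 * (Real.sqrt 2 * ‖linkEmbed L v‖))
      (by positivity : 0 ≤ Real.sqrt 2 * ‖linkEmbed L v'‖) (3 * n)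
    have hA := pow_add_three_le (Real.sqrt_nonneg (t / β)) (by positivity : 0 ≤ 3 * τw) (by positivity : 0 ≤ 3 * τw) (3 * n)
    have hD : Real.sqrt (t / β) = Real.sqrt t * sβ := by rw [hsβ, Real.sqrt_div ht, div_eq_mul_inv]
    have hββ : Real.sqrt β * sβ = 1 := by rw [hsβ, mul_inv_cancel₀ (Real.sqrt_pos.mpr hβ).ne']
    have ea : Real.sqrt (t / β) ^ (3 * n) = sβ ^ (3 * n) * Real.sqrt t ^ (3 * n) := by rw [hD, mul_pow, mul_comm]
    have ed : (3 * τw) ^ (3 * n) = sβ ^ (3 * n) * (Real.sqrt β * (3 * τw)) ^ (3 * n) := by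
      rw [← mul_pow, ← mul_assoc, mul_comm sβ, hββ, one_mul]
    have eb : (5 * (Real.sqrt 2 * ‖linkEmbed L v‖)) ^ (3 * n) = sβ ^ (3 * n) * ((5 * Real.sqrt 2) ^ (3 * n) * (Real.sqrt β * ‖linkEmbed L v‖) ^ (3 * n)) := by
      have e : 5 * (Real.sqrt 2 * ‖linkEmbed L v‖) = sβ * ((5 * Real.sqrt 2) * (Real.sqrt β * ‖linkEmbed L v‖)) := by
        calc 5 * (Real.sqrt 2 * ‖linkEmbed L v‖) = (Real.sqrt β * sβ) * (5 * (Real.sqrt 2 * ‖linkEmbed L v‖)) := by rw [hββ, one_mul]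
          _ = sβ * ((5 * Real.sqrt 2) * (Real.sqrt β * ‖linkEmbed L v‖)) := by ring
      rw [e, mul_pow, mul_pow]
    have ec : (Real.sqrt 2 * ‖linkEmbed L v'‖) ^ (3 * n) = sβ ^ (3 * n) * (Real.sqrt 2 ^ (3 * n) * (Real.sqrt β * ‖linkEmbed L v'‖) ^ (3 * n)) := by
      have e : Real.sqrt 2 * ‖linkEmbed L v'‖ = sβ * (Real.sqrt 2 * (Real.sqrt β * ‖linkEmbed L v'‖)) := by
        calc Real.sqrt 2 * ‖linkEmbed L v'‖ = (Real.sqrt β * sβ) * (Real.sqrt 2 * ‖linkEmbed L v'‖) := by rw [hββ, one_mul]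
          _ = sβ * (Real.sqrt 2 * (Real.sqrt β * ‖linkEmbed L v'‖)) := by ring
      rw [e, mul_pow, mul_pow]
    have hsq1 : Real.sqrt t ≤ t + 1 := by rw [Real.sqrt_le_left (by linarith)]; nlinarith
    have hst : Real.sqrt t ^ (3 * n) ≤ (t + 1) ^ (3 * n) := pow_le_pow_left₀ (Real.sqrt_nonneg _) hsq1 _
    have hs0 : 0 ≤ sβ ^ (3 * n) := pow_nonneg hsβ0.le _
    have ht1 : 1 ≤ (t + 1) ^ (3 * n) := one_le_pow₀ (by linarith)
    rw [ea, ed] at hA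
    rw [eb, ec] at h3
    have hd0 : 0 ≤ (Real.sqrt β * (3 * τw)) ^ (3 * n) := by positivity
    have hb0 : 0 ≤ (5 * Real.sqrt 2) ^ (3 * n) * (Real.sqrt β * ‖linkEmbed L v‖) ^ (3 * n) := by positivity
    have hc0 : 0 ≤ Real.sqrt 2 ^ (3 * n) * (Real.sqrt β * ‖linkEmbed L v'‖) ^ (3 * n) := by positivity
    -- `A^{3n} ≤ sβ^{3n}·Aw·(t+1)^{3n}`
    have hA' : (Real.sqrt (t / β) + 3 * τw + 3 * τw) ^ (3 * n) ≤ sβ ^ (3 * n) * (Aw * (t + 1) ^ (3 * n)) := by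
      refine hA.trans ?_
      rw [hAw]
      have h4 : sβ ^ (3 * n) * Real.sqrt t ^ (3 * n) ≤ sβ ^ (3 * n) * (t + 1) ^ (3 * n) := mul_le_mul_of_nonneg_left hst hs0
      have h5 : sβ ^ (3 * n) * (Real.sqrt β * (3 * τw)) ^ (3 * n) ≤ sβ ^ (3 * n) * (Real.sqrt β * (3 * τw)) ^ (3 * n) * (t + 1) ^ (3 * n) :=
        le_mul_of_one_le_right (mul_nonneg hs0 hd0) ht1
      have h33 : (0 : ℝ) ≤ 3 ^ (3 * n) := by positivity
      have hlin : sβ ^ (3 * n) * Real.sqrt t ^ (3 * n) + sβ ^ (3 * n) * (Real.sqrt β * (3 * τw)) ^ (3 * n) + sβ ^ (3 * n) * (Real.sqrt β * (3 * τw)) ^ (3 * n) ≤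
          sβ ^ (3 * n) * (t + 1) ^ (3 * n) + 2 * (sβ ^ (3 * n) * (Real.sqrt β * (3 * τw)) ^ (3 * n) * (t + 1) ^ (3 * n)) := by linarith
      calc (3 : ℝ) ^ (3 * n) * (sβ ^ (3 * n) * Real.sqrt t ^ (3 * n) + sβ ^ (3 * n) * (Real.sqrt β * (3 * τw)) ^ (3 * n) + sβ ^ (3 * n) * (Real.sqrt β * (3 * τw)) ^ (3 * n))
          ≤ 3 ^ (3 * n) * (sβ ^ (3 * n) * (t + 1) ^ (3 * n) + 2 * (sβ ^ (3 * n) * (Real.sqrt β * (3 * τw)) ^ (3 * n) * (t + 1) ^ (3 * n))) := mul_le_mul_of_nonneg_left hlin h33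
        _ = sβ ^ (3 * n) * (3 ^ (3 * n) * (1 + 2 * (Real.sqrt β * (3 * τw)) ^ (3 * n)) * (t + 1) ^ (3 * n)) := by ring
    have h33 : (0 : ℝ) ≤ 3 ^ (3 * n) := by positivity
    have h7 := le_trans h3 (mul_le_mul_of_nonneg_left (add_le_add (add_le_add hA' le_rfl) le_rfl) h33)
    have hK0 : 0 ≤ (π ^ 2 / 12) ^ n * (3 * (L : ℝ)) ^ (3 * n) := by positivity
    calc (π ^ 2 / 12) ^ n * (3 * (L : ℝ)) ^ (3 * n) * ((Real.sqrt (t / β) + 3 * τw + 3 * τw) + 5 * (Real.sqrt 2 * ‖linkEmbed L v‖) + Real.sqrt 2 * ‖linkEmbed L v'‖) ^ (3 * n)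
        ≤ (π ^ 2 / 12) ^ n * (3 * (L : ℝ)) ^ (3 * n) * (3 ^ (3 * n) * (sβ ^ (3 * n) * (Aw * (t + 1) ^ (3 * n)) +
            sβ ^ (3 * n) * ((5 * Real.sqrt 2) ^ (3 * n) * (Real.sqrt β * ‖linkEmbed L v‖) ^ (3 * n)) +
            sβ ^ (3 * n) * (Real.sqrt 2 ^ (3 * n) * (Real.sqrt β * ‖linkEmbed L v'‖) ^ (3 * n)))) := mul_le_mul_of_nonneg_left h7 hK0
      _ = _ := by ring
  -- integrability of the profile moments
  have hΩvb : ∀ v : Edge 3 L → Fin 3 → ℝ, |Ω (linkEmbed L v)| ≤ CΩ := fun v => hCΩ _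
  have hΩvi : Integrable (fun v : Edge 3 L → Fin 3 → ℝ => Ω (linkEmbed L v)) π' := integrable_of_measurable_abs_le _ (hΩm.comp hle) hΩvb
  have hmom_b : ∀ v : Edge 3 L → Fin 3 → ℝ, |Ω (linkEmbed L v) * (Real.sqrt β * ‖linkEmbed L v‖) ^ (3 * n)| ≤ CΩ * (Real.sqrt β * |R|) ^ (3 * n) := fun v => by
    by_cases hz : Ω (linkEmbed L v) = 0
    · rw [hz, zero_mul, abs_zero]; positivity
    · rw [abs_mul, abs_of_nonneg (by positivity : 0 ≤ (Real.sqrt β * ‖linkEmbed L v‖) ^ (3 * n))]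
      exact mul_le_mul (hCΩ _) (pow_le_pow_left₀ (by positivity) (mul_le_mul_of_nonneg_left (((hΩt v hz).2).trans (le_abs_self R)) (Real.sqrt_nonneg _)) _)
        (by positivity) hCΩ0
  have hmom_m : Measurable fun v : Edge 3 L → Fin 3 → ℝ => Ω (linkEmbed L v) * (Real.sqrt β * ‖linkEmbed L v‖) ^ (3 * n) := (hΩm.comp hle).mul ((hle.norm.const_mul _).pow_const _)
  have hmom_i : Integrable (fun v : Edge 3 L → Fin 3 → ℝ => Ω (linkEmbed L v) * (Real.sqrt β * ‖linkEmbed L v‖) ^ (3 * n)) π' := integrable_of_measurable_abs_le _ hmom_m hmom_b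
  -- the constant
  set K : ℝ := (π ^ 2 / 12) ^ n * (3 * (L : ℝ)) ^ (3 * n) * 3 ^ (3 * n) * sβ ^ (3 * n) with hK
  have hK0 : 0 ≤ K := by rw [hK]; positivity
  set a₁ : ℝ := (5 * Real.sqrt 2) ^ (3 * n) with ha₁
  set a₂ : ℝ := Real.sqrt 2 ^ (3 * n) with ha₂
  -- inner integral in v′
  have hinner : ∀ v : Edge 3 L → Fin 3 → ℝ, ∫ v', Ω (linkEmbed L v) * Ω (linkEmbed L v') *
      (π ^ 2 / 12 * (3 * L * (Real.sqrt (t / β) + 5 * (Real.sqrt 2 * ‖linkEmbed L v‖ + τw) + (Real.sqrt 2 * ‖linkEmbed L v'‖ + τw))) ^ 3) ^ n ∂π' ≤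
      Ω (linkEmbed L v) * (K * ((Aw * (t + 1) ^ (3 * n) + a₁ * (Real.sqrt β * ‖linkEmbed L v‖) ^ (3 * n)) * I₀ + a₂ * Mm)) := by
    intro v
    have hΩv0 : 0 ≤ Ω (linkEmbed L v) := hΩ0 _
    have hpt : ∀ v', Ω (linkEmbed L v) * Ω (linkEmbed L v') *
        (π ^ 2 / 12 * (3 * L * (Real.sqrt (t / β) + 5 * (Real.sqrt 2 * ‖linkEmbed L v‖ + τw) + (Real.sqrt 2 * ‖linkEmbed L v'‖ + τw))) ^ 3) ^ n ≤
        Ω (linkEmbed L v) * (K * ((Aw * (t + 1) ^ (3 * n) + a₁ * (Real.sqrt β * ‖linkEmbed L v‖) ^ (3 * n)) * Ω (linkEmbed L v') +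
          a₂ * (Ω (linkEmbed L v') * (Real.sqrt β * ‖linkEmbed L v'‖) ^ (3 * n)))) := fun v' => by
      have h := mul_le_mul_of_nonneg_left (hbox v v') (mul_nonneg hΩv0 (hΩ0 (linkEmbed L v')))
      refine h.trans (le_of_eq ?_)
      rw [hK, ha₁, ha₂]; ring
    have hrhs_i : Integrable (fun v' => Ω (linkEmbed L v) * (K * ((Aw * (t + 1) ^ (3 * n) + a₁ * (Real.sqrt β * ‖linkEmbed L v‖) ^ (3 * n)) * Ω (linkEmbed L v') +
          a₂ * (Ω (linkEmbed L v') * (Real.sqrt β * ‖linkEmbed L v'‖) ^ (3 * n))))) π' :=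
      (((hΩvi.const_mul _).add (hmom_i.const_mul _)).const_mul _).const_mul _
    by_cases hlhs : Integrable (fun v' => Ω (linkEmbed L v) * Ω (linkEmbed L v') *
        (π ^ 2 / 12 * (3 * L * (Real.sqrt (t / β) + 5 * (Real.sqrt 2 * ‖linkEmbed L v‖ + τw) + (Real.sqrt 2 * ‖linkEmbed L v'‖ + τw))) ^ 3) ^ n) π'
    · refine (integral_mono hlhs hrhs_i hpt).trans (le_of_eq ?_)
      rw [integral_const_mul, integral_const_mul, integral_add (hΩvi.const_mul _) (hmom_i.const_mul _), integral_const_mul, integral_const_mul]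
    · rw [integral_undef hlhs]
      exact mul_nonneg hΩv0 (mul_nonneg hK0 (add_nonneg (mul_nonneg (by positivity) hI₀0) (mul_nonneg (by positivity) hMm0)))
  -- outer integral in v
  have hout_i : Integrable (fun v => Ω (linkEmbed L v) * (K * ((Aw * (t + 1) ^ (3 * n) + a₁ * (Real.sqrt β * ‖linkEmbed L v‖) ^ (3 * n)) * I₀ + a₂ * Mm))) π' := by
    have e : ∀ v, Ω (linkEmbed L v) * (K * ((Aw * (t + 1) ^ (3 * n) + a₁ * (Real.sqrt β * ‖linkEmbed L v‖) ^ (3 * n)) * I₀ + a₂ * Mm)) =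
        (K * (Aw * (t + 1) ^ (3 * n) * I₀ + a₂ * Mm)) * Ω (linkEmbed L v) + (K * a₁ * I₀) * (Ω (linkEmbed L v) * (Real.sqrt β * ‖linkEmbed L v‖) ^ (3 * n)) := fun v => by ring
    simp_rw [e]
    exact (hΩvi.const_mul _).add (hmom_i.const_mul _)
  have hZ0 : 0 ≤ fpZ ε := by unfold fpZ; exact measureReal_nonneg
  have htot : ∫ v, ∫ v', Ω (linkEmbed L v) * Ω (linkEmbed L v') *
      (π ^ 2 / 12 * (3 * L * (Real.sqrt (t / β) + 5 * (Real.sqrt 2 * ‖linkEmbed L v‖ + τw) + (Real.sqrt 2 * ‖linkEmbed L v'‖ + τw))) ^ 3) ^ n ∂π' ∂π' ≤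
      K * ((Aw * (t + 1) ^ (3 * n) * I₀ + a₂ * Mm) * I₀ + a₁ * I₀ * Mm) := by
    by_cases hlhs : Integrable (fun v => ∫ v', Ω (linkEmbed L v) * Ω (linkEmbed L v') *
        (π ^ 2 / 12 * (3 * L * (Real.sqrt (t / β) + 5 * (Real.sqrt 2 * ‖linkEmbed L v‖ + τw) + (Real.sqrt 2 * ‖linkEmbed L v'‖ + τw))) ^ 3) ^ n ∂π') π'
    · refine (integral_mono hlhs hout_i hinner).trans (le_of_eq ?_)
      have e : ∀ v, Ω (linkEmbed L v) * (K * ((Aw * (t + 1) ^ (3 * n) + a₁ * (Real.sqrt β * ‖linkEmbed L v‖) ^ (3 * n)) * I₀ + a₂ * Mm)) =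
          (K * (Aw * (t + 1) ^ (3 * n) * I₀ + a₂ * Mm)) * Ω (linkEmbed L v) + (K * a₁ * I₀) * (Ω (linkEmbed L v) * (Real.sqrt β * ‖linkEmbed L v‖) ^ (3 * n)) := fun v => by ring
      simp_rw [e]
      rw [integral_add (hΩvi.const_mul _) (hmom_i.const_mul _), integral_const_mul, integral_const_mul]
      ring
    · rw [integral_undef hlhs]
      exact mul_nonneg hK0 (add_nonneg (mul_nonneg (add_nonneg (mul_nonneg (by positivity) hI₀0) (mul_nonneg (by positivity) hMm0)) hI₀0)
        (mul_nonneg (mul_nonneg (by positivity) hI₀0) hMm0))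
  -- finish: multiply by fpZ and compare with the stated constant (using `(t+1)^{3n} ≥ 1` on the moment terms)
  have ht1 : 1 ≤ (t + 1) ^ (3 * n) := one_le_pow₀ (by linarith)
  calc fpZ ε * ∫ v, ∫ v', Ω (linkEmbed L v) * Ω (linkEmbed L v') *
        (π ^ 2 / 12 * (3 * L * (Real.sqrt (t / β) + 5 * (Real.sqrt 2 * ‖linkEmbed L v‖ + τw) + (Real.sqrt 2 * ‖linkEmbed L v'‖ + τw))) ^ 3) ^ n ∂π' ∂π'
      ≤ fpZ ε * (K * ((Aw * (t + 1) ^ (3 * n) * I₀ + a₂ * Mm) * I₀ + a₁ * I₀ * Mm)) := mul_le_mul_of_nonneg_left htot hZ0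
    _ ≤ fpZ ε * (K * ((Aw * I₀ ^ 2 + (a₁ + a₂) * I₀ * Mm) * (t + 1) ^ (3 * n))) := by
        apply mul_le_mul_of_nonneg_left _ hZ0
        apply mul_le_mul_of_nonneg_left _ hK0
        have h1 : a₂ * Mm * I₀ ≤ a₂ * I₀ * Mm * (t + 1) ^ (3 * n) := by
          have : 0 ≤ a₂ * I₀ * Mm := by positivity
          nlinarith
        have h2 : a₁ * I₀ * Mm ≤ a₁ * I₀ * Mm * (t + 1) ^ (3 * n) := by
          have : 0 ≤ a₁ * I₀ * Mm := by positivity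
          nlinarith
        nlinarith [h1, h2, sq_nonneg I₀, hAw0]
    _ = (fpZ ε * ((π ^ 2 / 12) ^ n * (3 * (L : ℝ)) ^ (3 * n) * 3 ^ (3 * n) * sβ ^ (3 * n)) * (Aw * I₀ ^ 2 + (a₁ + a₂) * I₀ * Mm)) * (t + 1) ^ (3 * n) := by
        rw [hK]; ring
    _ = _ := by rw [hAw]


end Summit.QuantumFields.YangMills.Theorems.FemtoTransferGap.RateTube

end
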